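import Literature.AlgebraicGeometry.Frobenioids.Thm49AsPrinted
import Literature.AlgebraicGeometry.Frobenioids.Thm49OfPreStepsWeak
import Literature.AlgebraicGeometry.Frobenioids.Thm49CompatOfPreStepsWeak
import HarnessLib

/-!
# [FrdI] Theorem 4.9 AS TYPED (`Thm49`, `Thm49_compat` at `ofFunctor`), in print's generality, for EVERY pair of
# Frobenioids with WEAKLY perf-factorial `Φ_i` — no base-type hypothesis

Mochizuki, *The geometry of Frobenioids I: the general theory*, Kyushu J. Math. **62** (2008)
293–400, §4, Theorem 4.9, statement p. 88 l. 33 – p. 89 l. 2, proof p. 89 l. 3 – p. 90 l. 54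
[cite: MochizukiFrdI2008, Thm. 4.9 p.88]; Theorem 3.4 (ii) p. 62 (2008 FSMFF wording); Definition 4.5 (iii) p. 87.

PROOF-ONLY file (cell abc-iut, layer L1, seat abc-iut-L1-t14; row «T49-ASPRINTED-WEAK»). WEAK-HYPOTHESIS TWINS of
the five closers of `Thm49AsPrinted.lean` (seat abc-iut-w4-d105 lineage) with "`Φ_i` perf-factorial" (Def. 2.4 (i)
(a)–(d), §4 standing assumption p. 75) weakened to "`Φ_i` weakly perf-factorial" (`IsPerfFactorialWeak` =
(a)(b)(c) + (d_ord) + (d_res); cell finding F-L2d2-1 — the divisor monoids of the tempered Frobenioids of [EtTh]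
§3–§5, where [EtTh] Cor. 3.8 (iii) p. 81 and Prop. 5.3 p. 99 quote Thm. 4.9):
`FrdI.T49.thm49_ofFunctor_weak` (**the typed NODES row `PreFrobenioidData.Thm49` for EVERY pair of Frobenioids with
weakly perf-factorial `Φ_i`, every `Ψ`, arbitrary `R_i : RSParams`, `C₁` rational at THE birationalization /
support**), `thm49_ofFunctor_primarySupp_weak`, `exists_thm49_compat_ofFunctor_weak` (the typed `Thm49_compat` for
THE `Ψ^Prime`), `exists_divisorMonoidIsoOver_thm49_compat_forall_ofFunctor_weak`, `thm49_rsParams_weak` (at the NAMED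
parameters `PreFrobenioid.rsParams`). Inputs BY NAME: `thm49_ofFunctor_of_preservesPreSteps_weak`
(`Thm49OfPreStepsWeak.lean`), `exists_thm49_compat_ofFunctor_of_preservesPreSteps_weak` /
`exists_divisorMonoidIsoOver_thm49_compat_forall_of_preservesPreSteps_weak` (`Thm49CompatOfPreStepsWeak.lean`), and
Thm. 3.4 (ii) AS PRINTED (`FrdI.isPreStep_map_of_quasiIsotropic_of_isOfFSMFFType`, hypothesis-free in the monoids).
The printed case is `Thm49AsPrinted.lean` itself, equivalently these theorems at `fun X => (hpf_i X).weak`. No new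
definitions; nothing of the paper restated or strengthened; nothing here is specific to the abc programme and no
side is taken on [IUTchIII] Cor. 3.12.
-/

namespace Literature.AlgebraicGeometry.Frobenioids

namespace FrdI.T49

open CategoryTheory Opposite PreFrobenioidData

universe w v v' u u'

variable {D₁ : Type u} [Category.{v} D₁] {Φ₁ : D₁ᵒᵖ ⥤ CommMonCat.{w}} {C₁ : Type u'} [Category.{v'} C₁]
  {D₂ : Type u} [Category.{v} D₂] {Φ₂ : D₂ᵒᵖ ⥤ CommMonCat.{w}} {C₂ : Type u'} [Category.{v'} C₂]
  {F₁ : C₁ ⥤ ElemFrobenioid Φ₁} {F₂ : C₂ ⥤ ElemFrobenioid Φ₂}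


/-! ### Theorem 4.9 itself (the typed `Thm49` at `ofFunctor`) -/

/-- (WEAK monoids: `Φ_i` weakly perf-factorial; twin of the strong closer of the same name without `_weak`.) **[FrdI] Theorem 4.9 AS TYPED (`PreFrobenioidData.Thm49` at `ofFunctor`), for EVERY pair of Frobenioids —
no base-type hypothesis** — with perf-factorial `Φ_i` and `C₁` of rational type at THE birationalization /
primary support: for `C_i` of rationally standard type there is an isomorphism of functors `Ψ^Φ : Φ₁ ⥲ Φ₂`
lying over `Ψ`. Proof = abc-iut-w4-d105's `thm49_ofFunctor_of_preservesPreSteps_weak` (print p. 89: group-like case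
trivial; isotropifications, Thm. 3.4 (iii) for `Ψ^istr` from pre-step preservation, perfections, Rmk. 4.5.1 +
Prop. 5.5 (iii) rationality, the perfect core, descents) with "`Ψ`, `Ψ⁻¹` preserve pre-steps" supplied by
Thm. 3.4 (ii) AS PRINTED (`FrdI.isPreStep_map_of_quasiIsotropic_of_isOfFSMFFType`), whose hypotheses
"quasi-isotropic" and "`D_i` of FSMFF-type" are clauses of the antecedent "rationally standard type".
[cite: MochizukiFrdI2008, Thm. 4.9 p.88] -/
theorem thm49_ofFunctor_weak (hF₁ : PreFrobenioid.IsFrobenioid F₁) (hF₂ : PreFrobenioid.IsFrobenioid F₂)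
    (hpf₁ : Objectwise (fun M _ => IsPerfFactorialWeak M) Φ₁) (hpf₂ : Objectwise (fun M _ => IsPerfFactorialWeak M) Φ₂)
    (hrat₁ : ∀ A : C₁, PreFrobenioidData.IsRational
      (PreFrobenioid.biratData hF₁ (PreFrobenioid.hasBiratSquares_of_isFrobenioid hF₁))
      (S := ofFunctor Φ₁ F₁) (fun a 𝔭 => PrimarySupp a 𝔭) A)
    (Ψ : C₁ ≌ C₂) (R₁ : (ofFunctor Φ₁ F₁).RSParams) (R₂ : (ofFunctor Φ₂ F₂).RSParams) :
    (ofFunctor Φ₁ F₁).Thm49 (ofFunctor Φ₂ F₂) Ψ R₁ R₂ := by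
  intro hR₁ hR₂
  have hs₁ := hR₁.standard
  have hs₂ := hR₂.standard
  exact thm49_ofFunctor_of_preservesPreSteps_weak hF₁ hF₂ hpf₁ hpf₂ hrat₁ Ψ
    (fun _ _ _ h => FrdI.isPreStep_map_of_quasiIsotropic_of_isOfFSMFFType hF₁ hF₂ hs₁.quasiIsotropic
      hs₂.quasiIsotropic hs₂.fsmff Ψ h)
    (fun _ _ _ h => FrdI.isPreStep_map_of_quasiIsotropic_of_isOfFSMFFType hF₂ hF₁ hs₂.quasiIsotropic
      hs₁.quasiIsotropic hs₁.fsmff Ψ.symm h)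
    R₁ R₂ hR₁ hR₂

/-- (WEAK monoids: `Φ_i` weakly perf-factorial; twin of the strong closer of the same name without `_weak`.) **[FrdI] Theorem 4.9 AS TYPED at `ofFunctor`, the rationality input read off the antecedent**: when the
parameter `R₁` carries THE birationalization `C₁^birat` (Prop. 4.4, at the square-completions of Prop. 1.11 (vii))
and the primary support of Def. 2.4 (i)(d) — the data at which the tree's producers establish "rational type" —
clause (a) "rational type" of "`C₁` of rationally standard type" IS the rationality input of `thm49_ofFunctor_weak`, so
the typed Thm. 4.9 holds for every pair of Frobenioids with perf-factorial `Φ_i`, every `Ψ`, every `R₂` and every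
choice of the remaining (`C^un-tr`-) components of `R₁`. [cite: MochizukiFrdI2008, Thm. 4.9 p.88] -/
theorem thm49_ofFunctor_primarySupp_weak (hF₁ : PreFrobenioid.IsFrobenioid F₁) (hF₂ : PreFrobenioid.IsFrobenioid F₂)
    (hpf₁ : Objectwise (fun M _ => IsPerfFactorialWeak M) Φ₁) (hpf₂ : Objectwise (fun M _ => IsPerfFactorialWeak M) Φ₂)
    (Ψ : C₁ ≌ C₂) (SU₁ : PreFrobenioidData.{w} (ofFunctor Φ₁ F₁).Untr D₁) (BU₁ : SU₁.BiratData)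
    (R₂ : (ofFunctor Φ₂ F₂).RSParams) :
    (ofFunctor Φ₁ F₁).Thm49 (ofFunctor Φ₂ F₂) Ψ
      ⟨PreFrobenioid.biratData hF₁ (PreFrobenioid.hasBiratSquares_of_isFrobenioid hF₁),
        fun a 𝔭 => PrimarySupp a 𝔭, SU₁, BU₁⟩ R₂ :=
  fun hR₁ hR₂ => thm49_ofFunctor_weak hF₁ hF₂ hpf₁ hpf₂ (fun A => hR₁.rational A) Ψ _ R₂ hR₁ hR₂

/-! ### Theorem 4.9 with its compatibility clause (the typed `Thm49_compat` at `ofFunctor`): existence -/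

/-- (WEAK monoids: `Φ_i` weakly perf-factorial; twin of the strong closer of the same name without `_weak`.) **[FrdI] Theorem 4.9 WITH its compatibility clause, AT THE `C`-LEVEL, for EVERY pair of Frobenioids in the
clause's own scope — no base-type hypothesis**: under `Thm42Setting` (standard type; isotropic, non-group-like
types), `Φ_i` perf-factorial, `C₁` of rational type at THE constructions, there exist THE `Ψ^Prime` of
Thm. 4.2 (ii) (clauses (a), (b)) and a `Ψ^Φ : Φ₁ ⥲ Φ₂` over `Ψ` with the divisor clause on pre-steps,
satisfying the typed `PreFrobenioidData.Thm49_compat` (print p. 89 ll. 1–2, "from the construction"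
ll. 12–33). Route = abc-iut-w4-d099/w4-d105's `exists_thm49_compat_ofFunctor_of_preservesPreSteps_weak` with the
pre-step clause of Thm. 3.4 (ii) AS PRINTED (`FrdI.isPreStep_map_of_quasiIsotropic_of_isOfFSMFFType`; its
FSMFF hypothesis is (d) of standard type). [cite: MochizukiFrdI2008, Thm. 4.9 p.89] -/
theorem exists_thm49_compat_ofFunctor_weak (hF₁ : PreFrobenioid.IsFrobenioid F₁)
    (hF₂ : PreFrobenioid.IsFrobenioid F₂)
    (hpf₁ : Objectwise (fun M _ => IsPerfFactorialWeak M) Φ₁) (hpf₂ : Objectwise (fun M _ => IsPerfFactorialWeak M) Φ₂)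
    (hrat₁ : ∀ A : C₁, PreFrobenioidData.IsRational
      (PreFrobenioid.biratData hF₁ (PreFrobenioid.hasBiratSquares_of_isFrobenioid hF₁))
      (S := ofFunctor Φ₁ F₁) (fun a 𝔭 => PrimarySupp a 𝔭) A)
    (Ψ : C₁ ≌ C₂) (hT : Thm42Setting (ofFunctor Φ₁ F₁) (ofFunctor Φ₂ F₂)) :
    ∃ (E : DivisorMonoidIsoOver (ofFunctor Φ₁ F₁) (ofFunctor Φ₂ F₂) Ψ)
      (e : ∀ A : C₁, Primes (Φ₁.obj (op (PreFrobenioid.baseObj F₁ A))) ≃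
        Primes (Φ₂.obj (op (PreFrobenioid.baseObj F₂ (Ψ.functor.obj A))))),
      (∀ (A : C₁) (𝔭 : Primes (Φ₁.obj (op (PreFrobenioid.baseObj F₁ A)))),
        (∀ ⦃B : C₁⦄ (φ : A ⟶ B), PreFrobenioid.IsCoAngularPreStep F₁ φ →
            (PreFrobenioid.Div F₁ φ ∈ 𝔭.submonoid ↔
              PreFrobenioid.Div F₂ (Ψ.functor.map φ) ∈ (e A 𝔭).submonoid)) ∧
        ∀ ⦃B : C₁⦄ (ψ : B ⟶ A), PreFrobenioid.IsCoAngularPreStep F₁ ψ →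
          ((∃ y ∈ 𝔭.submonoid, pull Φ₁ (PreFrobenioid.Base F₁ ψ) y = PreFrobenioid.Div F₁ ψ) ↔
            ∃ y ∈ (e A 𝔭).submonoid, pull Φ₂ (PreFrobenioid.Base F₂ (Ψ.functor.map ψ)) y =
              PreFrobenioid.Div F₂ (Ψ.functor.map ψ))) ∧
      (∀ ⦃A B : C₁⦄ (φ : A ⟶ B), PreFrobenioid.IsPreStep F₁ φ →
          E.iso A (PreFrobenioid.Div F₁ φ) = PreFrobenioid.Div F₂ (Ψ.functor.map φ)) ∧
      Literature.AlgebraicGeometry.Frobenioids.PreFrobenioidData.Thm49_compat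
        (ofFunctor Φ₁ F₁) (ofFunctor Φ₂ F₂) Ψ E e :=
  exists_thm49_compat_ofFunctor_of_preservesPreSteps_weak hF₁ hF₂ hpf₁ hpf₂ hrat₁ Ψ hT
    (fun _ _ _ h => FrdI.isPreStep_map_of_quasiIsotropic_of_isOfFSMFFType hF₁ hF₂
      hT.standard.1.quasiIsotropic hT.standard.2.quasiIsotropic hT.standard.2.fsmff Ψ h)
    (fun _ _ _ h => FrdI.isPreStep_map_of_quasiIsotropic_of_isOfFSMFFType hF₂ hF₁
      hT.standard.2.quasiIsotropic hT.standard.1.quasiIsotropic hT.standard.1.fsmff Ψ.symm h)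

/-- (WEAK monoids: `Φ_i` weakly perf-factorial; twin of the strong closer of the same name without `_weak`.) **Compatibility with EVERY prime-correspondence satisfying clause (a) of Thm. 4.2 (ii), for every pair of
Frobenioids in the clause's scope — no base-type hypothesis** (p. 89 ll. 1–2 with ll. 12–33 "from the
construction"): there is a `Ψ^Φ` over `Ψ` with the divisor clause on pre-steps which satisfies the typed
`Thm49_compat` against any family of bijections of primes `e` compatible with the divisors of co-angular
pre-steps. [cite: MochizukiFrdI2008, Thm. 4.9 p.89] -/
theorem exists_divisorMonoidIsoOver_thm49_compat_forall_ofFunctor_weak (hF₁ : PreFrobenioid.IsFrobenioid F₁)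
    (hF₂ : PreFrobenioid.IsFrobenioid F₂)
    (hpf₁ : Objectwise (fun M _ => IsPerfFactorialWeak M) Φ₁) (hpf₂ : Objectwise (fun M _ => IsPerfFactorialWeak M) Φ₂)
    (hrat₁ : ∀ A : C₁, PreFrobenioidData.IsRational
      (PreFrobenioid.biratData hF₁ (PreFrobenioid.hasBiratSquares_of_isFrobenioid hF₁))
      (S := ofFunctor Φ₁ F₁) (fun a 𝔭 => PrimarySupp a 𝔭) A)
    (Ψ : C₁ ≌ C₂) (hT : Thm42Setting (ofFunctor Φ₁ F₁) (ofFunctor Φ₂ F₂)) :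
    ∃ E : DivisorMonoidIsoOver (ofFunctor Φ₁ F₁) (ofFunctor Φ₂ F₂) Ψ,
      (∀ ⦃A B : C₁⦄ (φ : A ⟶ B), PreFrobenioid.IsPreStep F₁ φ →
          E.iso A (PreFrobenioid.Div F₁ φ) = PreFrobenioid.Div F₂ (Ψ.functor.map φ)) ∧
      ∀ (e : ∀ A : C₁, Primes (Φ₁.obj (op (PreFrobenioid.baseObj F₁ A))) ≃
          Primes (Φ₂.obj (op (PreFrobenioid.baseObj F₂ (Ψ.functor.obj A))))),
        (∀ (A : C₁) (𝔭 : Primes (Φ₁.obj (op (PreFrobenioid.baseObj F₁ A)))) ⦃B : C₁⦄ (φ : A ⟶ B),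
          PreFrobenioid.IsCoAngularPreStep F₁ φ →
            (PreFrobenioid.Div F₁ φ ∈ 𝔭.submonoid ↔
              PreFrobenioid.Div F₂ (Ψ.functor.map φ) ∈ (e A 𝔭).submonoid)) →
        Literature.AlgebraicGeometry.Frobenioids.PreFrobenioidData.Thm49_compat
          (ofFunctor Φ₁ F₁) (ofFunctor Φ₂ F₂) Ψ E e :=
  exists_divisorMonoidIsoOver_thm49_compat_forall_of_preservesPreSteps_weak hF₁ hF₂ hpf₁ hpf₂ hrat₁ Ψ hT
    (fun _ _ _ h => FrdI.isPreStep_map_of_quasiIsotropic_of_isOfFSMFFType hF₁ hF₂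
      hT.standard.1.quasiIsotropic hT.standard.2.quasiIsotropic hT.standard.2.fsmff Ψ h)
    (fun _ _ _ h => FrdI.isPreStep_map_of_quasiIsotropic_of_isOfFSMFFType hF₂ hF₁
      hT.standard.2.quasiIsotropic hT.standard.1.quasiIsotropic hT.standard.1.fsmff Ψ.symm h)

/-! ### At the NAMED parameters `PreFrobenioid.rsParams` (v2, additive) -/

/-- (WEAK monoids: `Φ_i` weakly perf-factorial; twin of the strong closer of the same name without `_weak`.) **[FrdI] Theorem 4.9 AS TYPED at the NAMED parameters `PreFrobenioid.rsParams hF₁ PrimarySupp`** — THE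
Def. 4.5 (iii) data `(C₁^birat, Supp, C₁^un-tr, (C₁^un-tr)^birat)` (abc-iut-L6-t6 / L1-t5 lineage, `Prop55Sub.lean`)
with the primary support of Def. 2.4 (i)(d), the vocabulary in which the tree's producers of "rationally standard
type" are stated — for EVERY pair of Frobenioids with perf-factorial `Φ_i`, every `Ψ`, every `R₂`; no base-type
hypothesis, no rationality input (it is clause (a) of the antecedent). Definitionally `thm49_ofFunctor_primarySupp_weak`.
[cite: MochizukiFrdI2008, Thm. 4.9 p.88] -/
theorem thm49_rsParams_weak (hF₁ : PreFrobenioid.IsFrobenioid F₁) (hF₂ : PreFrobenioid.IsFrobenioid F₂)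
    (hpf₁ : Objectwise (fun M _ => IsPerfFactorialWeak M) Φ₁) (hpf₂ : Objectwise (fun M _ => IsPerfFactorialWeak M) Φ₂)
    (Ψ : C₁ ≌ C₂) (R₂ : (ofFunctor Φ₂ F₂).RSParams) :
    (ofFunctor Φ₁ F₁).Thm49 (ofFunctor Φ₂ F₂) Ψ (PreFrobenioid.rsParams hF₁ fun a 𝔭 => PrimarySupp a 𝔭) R₂ :=
  thm49_ofFunctor_primarySupp_weak hF₁ hF₂ hpf₁ hpf₂ Ψ _ _ R₂

end FrdI.T49

end Literature.AlgebraicGeometry.Frobenioids
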